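import Summits.CriticalPhenomena.PercolationContinuityZ3.Theorems.PercNearOneGluingNoHeavyLowerTailThreePointCPIAdjacentPort
import HarnessLib

/-!
# The root entry lemma of the decision-tree resummation for the 3-point CPI

Crux `stmt-CriticalPhenomena-4575`, route `PercNearOneGluingNoHeavy`, fibre line; facecert memo gen 25
(`FINDING-gen25-DECISION-TREE-RESUMMATION.md`, §7 LEMMA Π₁).  For a finite multigraph `(V, α, ends)`
with terminals `t, t'` and port `c`, the decision-tree resummation writes the complementary-pair
inequality `CPI_C` as a sum over the leaves of any decision tree certifying `c ↔ {t,t'}`; the leaf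
obtained by revealing a single open label `a₀` joining `c` to `t` contributes
`C · #{z : z a₀ = true, t ↮ t' in z} − #{z : z a₀ = false, t ↮ t' in z}`
(separation counts of the contraction `G/a₀` and of the deletion `G∖a₀`).  This file proves that
this contribution is nonnegative for `C = 3` whenever `t` is the *likelier* terminal of the port,
`#{z : c ↔ t' in z} ≤ #{z : c ↔ t in z}` (`threePoint_rootEntry_three`): in the five-cell
bookkeeping of the partition of `{c, t, t'}` in the configurations with `a₀` closed the hypothesis
reads `X ≤ 2W + P₅` and the conclusion `X ≤ 2(W + P₅)`.  No definitions; vocabulary of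
`Literature/Probability/Percolation/ComplementPatternCounts.lean` (`labelledOpen`, `openGraph`), as in
`…ThreePointCPISigma` / `…ThreePointCPIAdjacentPort`.
-/

namespace Summit.CriticalPhenomena.PercolationContinuityZ3.Theorems.ThreePointCPIRootEntry

open Finset Literature.Probability.Percolation
open Summit.CriticalPhenomena.PercolationContinuityZ3.Theorems.ThreePointCPIAdjacentPort

variable {V α : Type*}

/-- **Reachability after opening one label.** If `ends a₀ = s(c, t)` with `c ≠ t`, then in the open
graph of `z[a₀ ↦ open]` the vertex `v` is reachable from `u` iff it is so in the open graph of `z`,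
or `u ↔ c` and `t ↔ v` there, or `u ↔ t` and `c ↔ v` there (a walk either avoids the edge `c–t` or
is cut at its last passage through it). [folklore] -/
theorem reachable_update_true_iff [DecidableEq α] (ends : α → Sym2 V) (z : α → Bool) (a₀ : α)
    {c t : V} (h₀ : ends a₀ = s(c, t)) (hct : c ≠ t) (u v : V) :
    (openGraph (labelledOpen ends (Function.update z a₀ true))).Reachable u v ↔
      ((openGraph (labelledOpen ends z)).Reachable u v ∨
        ((openGraph (labelledOpen ends z)).Reachable u c ∧
          (openGraph (labelledOpen ends z)).Reachable t v) ∨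
        ((openGraph (labelledOpen ends z)).Reachable u t ∧
          (openGraph (labelledOpen ends z)).Reachable c v)) := by
  classical
  set G := openGraph (labelledOpen ends (Function.update z a₀ true)) with hG
  set D := openGraph (labelledOpen ends z) with hD
  have hGD : ∀ x y, G.Adj x y → D.Adj x y ∨ s(x, y) = s(c, t) := fun x y hxy => by
    rcases adj_update_true ends z a₀ x y hxy with h | h
    · exact Or.inl h
    · exact Or.inr (h.trans h₀)
  have hadj : G.Adj c t := (openGraph_adj _ _ _).mpr ⟨⟨a₀, by simp, h₀⟩, hct⟩
  constructor
  · rintro ⟨p⟩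
    rcases reachable_or_of_walk hGD p with h | h | h
    · exact Or.inl h
    · -- t ↔ v in D; look at the reversed walk from v to u
      rcases reachable_or_of_walk hGD p.reverse with h' | h' | h'
      · exact Or.inl h'.symm
      · exact Or.inl (h'.symm.trans h)
      · exact Or.inr (Or.inl ⟨h'.symm, h⟩)
    · rcases reachable_or_of_walk hGD p.reverse with h' | h' | h'
      · exact Or.inl h'.symm
      · exact Or.inr (Or.inr ⟨h'.symm, h⟩)
      · exact Or.inl (h'.symm.trans h)
  · rintro (h | ⟨h1, h2⟩ | ⟨h1, h2⟩)
    · exact reachable_update_true ends z a₀ h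
    · exact ((reachable_update_true ends z a₀ h1).trans hadj.reachable).trans
        (reachable_update_true ends z a₀ h2)
    · exact ((reachable_update_true ends z a₀ h1).trans hadj.reachable.symm).trans
        (reachable_update_true ends z a₀ h2)

/-- Counting over the configurations with `a₀` open equals counting over those with `a₀` closed
after opening `a₀`: `#{z : z a₀ = true, P z} = #{z : z a₀ = false, P (z[a₀ ↦ open])}`
(the bijection `z ↦ z[a₀ ↦ closed]`). [folklore] -/
theorem card_filter_open_eq [Fintype α] [DecidableEq α] (a₀ : α) (P : (α → Bool) → Prop)
    [DecidablePred P] :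
    (univ.filter fun z : α → Bool => z a₀ = true ∧ P z).card =
      (univ.filter fun z : α → Bool => z a₀ = false ∧ P (Function.update z a₀ true)).card := by
  classical
  refine Finset.card_bij (fun z _ => Function.update z a₀ false) ?_ ?_ ?_
  · intro z hz
    simp only [mem_filter, mem_univ, true_and] at hz ⊢
    refine ⟨by simp, ?_⟩
    have : Function.update (Function.update z a₀ false) a₀ true = z := by
      funext a
      by_cases haa : a = a₀
      · subst haa; simp [hz.1]
      · simp [Function.update_of_ne haa]
    rw [this]; exact hz.2
  · intro z₁ hz₁ z₂ hz₂ heq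
    simp only [mem_filter, mem_univ, true_and] at hz₁ hz₂
    funext a
    by_cases haa : a = a₀
    · subst haa; rw [hz₁.1, hz₂.1]
    · have := congrArg (fun f => f a) heq
      simpa [Function.update_of_ne haa] using this
  · intro z hz
    simp only [mem_filter, mem_univ, true_and] at hz
    refine ⟨Function.update z a₀ true, ?_, ?_⟩
    · simp only [mem_filter, mem_univ, true_and]
      exact ⟨by simp, hz.2⟩
    · funext a
      by_cases haa : a = a₀
      · subst haa; simp [hz.1]
      · simp [Function.update_of_ne haa]

open Classical in
/-- **The root entry lemma (LEMMA Π₁, facecert gen 25 §7).** Let the label `a₀` join the port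
`c` to the terminal `t` (`ends a₀ = s(c,t)`, `c ≠ t`), and let `t` be the likelier terminal of
`c`: `#{z : c ↔ t' in z} ≤ #{z : c ↔ t in z}`.  Then
`#{z : z a₀ = false, t ↮ t' in z} ≤ 3 · #{z : z a₀ = true, t ↮ t' in z}`,
i.e. the separation count of the deletion `G∖a₀` is at most three times that of the contraction
`G/a₀`.  Proof: five-cell bookkeeping over the configurations with `a₀` closed — writing `W, X, P₅`
for the numbers of them with partition `ct|t'`, `ct'|t`, `c|t|t'` of `{c,t,t'}`, the hypothesis is
`X ≤ 2W + P₅`, the left side is `X + W + P₅` and the right side is `3(W + P₅)`. [this work] -/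
theorem threePoint_rootEntry_three [Fintype α] (ends : α → Sym2 V) (c t t' : V) (a₀ : α)
    (h₀ : ends a₀ = s(c, t)) (hct : c ≠ t)
    (hlik : (univ.filter fun z : α → Bool =>
        (openGraph (labelledOpen ends z)).Reachable c t').card ≤
      (univ.filter fun z : α → Bool => (openGraph (labelledOpen ends z)).Reachable c t).card) :
    (univ.filter fun z : α → Bool =>
        z a₀ = false ∧ ¬ (openGraph (labelledOpen ends z)).Reachable t t').card ≤
      3 * (univ.filter fun z : α → Bool =>
        z a₀ = true ∧ ¬ (openGraph (labelledOpen ends z)).Reachable t t').card := by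
  classical
  -- abbreviations for the three predicates on configurations (evaluated in `z` itself)
  set ct : (α → Bool) → Prop := fun z => (openGraph (labelledOpen ends z)).Reachable c t with hct_def
  set ct' : (α → Bool) → Prop := fun z => (openGraph (labelledOpen ends z)).Reachable c t'
    with hct'_def
  set tt' : (α → Bool) → Prop := fun z => (openGraph (labelledOpen ends z)).Reachable t t'
    with htt'_def
  -- elementary implications between the predicates
  have tri1 : ∀ z, ct z → ct' z → tt' z := fun z h1 h2 => h1.symm.trans h2
  have tri2 : ∀ z, tt' z → ct z → ct' z := fun z h1 h2 => h2.trans h1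
  have tri3 : ∀ z, tt' z → ct' z → ct z := fun z h1 h2 => h2.trans h1.symm
  -- (1) the right-hand side, transported to `a₀ = false`: `¬tt' ∧ ¬ct'`
  have hB : (univ.filter fun z : α → Bool => z a₀ = true ∧ ¬ tt' z).card =
      (univ.filter fun z : α → Bool => z a₀ = false ∧ (¬ tt' z ∧ ¬ ct' z)).card := by
    rw [card_filter_open_eq a₀ (fun z => ¬ tt' z)]
    congr 1; ext z
    simp only [mem_filter, mem_univ, true_and, and_congr_right_iff]
    intro _
    rw [htt'_def]; dsimp only
    rw [reachable_update_true_iff ends z a₀ h₀ hct t t']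
    constructor
    · intro h
      refine ⟨fun h' => h (Or.inl h'), fun h' => h (Or.inr (Or.inr ⟨SimpleGraph.Reachable.refl _, h'⟩))⟩
    · rintro ⟨h1, h2⟩ (h | ⟨h3, h4⟩ | ⟨h3, h4⟩)
      · exact h1 h
      · exact h1 h4
      · exact h2 h4
  -- (2) the hypothesis, transported: `#{ct}` over `a₀ = true` is everything, `#{ct'}` over
  --     `a₀ = true` is `#{ct' ∨ tt'}` over `a₀ = false`
  have hsplit : ∀ (P : (α → Bool) → Prop) [DecidablePred P],
      (univ.filter fun z : α → Bool => P z).card =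
        (univ.filter fun z : α → Bool => z a₀ = false ∧ P z).card +
          (univ.filter fun z : α → Bool => z a₀ = true ∧ P z).card := by
    intro P _
    have h := card_filter_add_card_filter_not (s := univ.filter fun z : α → Bool => P z)
      (fun z => z a₀ = false)
    rw [filter_filter, filter_filter] at h
    rw [← h]
    congr 1
    · congr 1; ext z; simp only [mem_filter, mem_univ, true_and]; tauto
    · congr 1; ext z; simp only [mem_filter, mem_univ, true_and, Bool.not_eq_false]; tauto
  have hCt : (univ.filter fun z : α → Bool => z a₀ = true ∧ ct z).card =
      (univ.filter fun z : α → Bool => z a₀ = false).card := by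
    rw [card_filter_open_eq a₀ ct]
    congr 1; ext z
    simp only [mem_filter, mem_univ, true_and, and_iff_left_iff_imp]
    intro _
    rw [hct_def]; dsimp only
    rw [reachable_update_true_iff ends z a₀ h₀ hct c t]
    exact Or.inr (Or.inl ⟨SimpleGraph.Reachable.refl _, SimpleGraph.Reachable.refl _⟩)
  have hCt' : (univ.filter fun z : α → Bool => z a₀ = true ∧ ct' z).card =
      (univ.filter fun z : α → Bool => z a₀ = false ∧ (ct' z ∨ tt' z)).card := by
    rw [card_filter_open_eq a₀ ct']
    congr 1; ext z
    simp only [mem_filter, mem_univ, true_and, and_congr_right_iff]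
    intro _
    rw [hct'_def]; dsimp only
    rw [reachable_update_true_iff ends z a₀ h₀ hct c t']
    constructor
    · rintro (h | ⟨-, h⟩ | ⟨h1, h2⟩)
      · exact Or.inl h
      · exact Or.inr h
      · exact Or.inl h2
    · rintro (h | h)
      · exact Or.inl h
      · exact Or.inr (Or.inl ⟨SimpleGraph.Reachable.refl _, h⟩)
  -- (3) cell decompositions over `H = {a₀ = false}`
  -- generic two-way split of a filter over H by a second predicate
  have split2 : ∀ (P Q : (α → Bool) → Prop) [DecidablePred P] [DecidablePred Q],
      (univ.filter fun z : α → Bool => z a₀ = false ∧ P z).card =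
        (univ.filter fun z : α → Bool => z a₀ = false ∧ (P z ∧ Q z)).card +
          (univ.filter fun z : α → Bool => z a₀ = false ∧ (P z ∧ ¬ Q z)).card := by
    intro P Q _ _
    have h := card_filter_add_card_filter_not
      (s := univ.filter fun z : α → Bool => z a₀ = false ∧ P z) (fun z => Q z)
    rw [filter_filter, filter_filter] at h
    rw [← h]
    congr 1
    · congr 1; ext z; simp only [mem_filter, mem_univ, true_and]; tauto
    · congr 1; ext z; simp only [mem_filter, mem_univ, true_and]; tauto
  -- names for the cell counts we need
  set X := (univ.filter fun z : α → Bool => z a₀ = false ∧ (¬ tt' z ∧ ct' z)).card with hX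
  set B := (univ.filter fun z : α → Bool => z a₀ = false ∧ (¬ tt' z ∧ ¬ ct' z)).card with hBdef
  set W := (univ.filter fun z : α → Bool => z a₀ = false ∧ (ct z ∧ ¬ tt' z)).card with hW
  set P1 := (univ.filter fun z : α → Bool => z a₀ = false ∧ (ct' z ∧ tt' z)).card with hP1
  set T := (univ.filter fun z : α → Bool => z a₀ = false ∧ tt' z).card with hT
  -- |A| = X + B
  have hA : (univ.filter fun z : α → Bool => z a₀ = false ∧ ¬ tt' z).card = X + B := by
    rw [split2 (fun z => ¬ tt' z) ct']
  -- |{H : ct'}| = P1 + X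
  have h1 : (univ.filter fun z : α → Bool => z a₀ = false ∧ ct' z).card = P1 + X := by
    rw [split2 ct' tt', hX]
    congr 2; ext z; simp only [mem_filter, mem_univ, true_and]; tauto
  -- |{H : ct' ∨ tt'}| = T + X
  have h2 : (univ.filter fun z : α → Bool => z a₀ = false ∧ (ct' z ∨ tt' z)).card = T + X := by
    rw [split2 (fun z => ct' z ∨ tt' z) tt', hT, hX]
    congr 1
    · congr 1; ext z; simp only [mem_filter, mem_univ, true_and]; tauto
    · congr 1; ext z; simp only [mem_filter, mem_univ, true_and]; tauto
  -- |{H : ct}| = P1 + W  (using ct ∧ tt' ↔ ct' ∧ tt')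
  have h3 : (univ.filter fun z : α → Bool => z a₀ = false ∧ ct z).card = P1 + W := by
    rw [split2 ct tt', hP1, hW]
    congr 2; ext z; simp only [mem_filter, mem_univ, true_and]
    constructor
    · rintro ⟨hz, h, h'⟩; exact ⟨hz, tri2 z h' h, h'⟩
    · rintro ⟨hz, h, h'⟩; exact ⟨hz, tri3 z h' h, h'⟩
  -- |H| = T + (X + B)
  have h4 : (univ.filter fun z : α → Bool => z a₀ = false).card = T + (X + B) := by
    have h := card_filter_add_card_filter_not
      (s := univ.filter fun z : α → Bool => z a₀ = false) (fun z => tt' z)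
    rw [filter_filter, filter_filter] at h
    rw [← h, hT, ← hA]
  -- W ≤ B (ct ∧ ¬tt' forces ¬ct')
  have hWB : W ≤ B := by
    rw [hW, hBdef]
    apply card_le_card
    intro z
    simp only [mem_filter, mem_univ, true_and]
    rintro ⟨hz, h, h'⟩
    exact ⟨hz, h', fun h'' => h' (tri1 z h h'')⟩
  -- the hypothesis in cell form: X ≤ W + B
  have hyp : (P1 + X) + (T + X) ≤ (P1 + W) + (T + (X + B)) := by
    have := hlik
    rw [hsplit ct', hsplit ct, hCt, hCt', h1, h2, h3, h4] at this
    exact this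
  -- conclude
  rw [hA, hB]
  omega

end Summit.CriticalPhenomena.PercolationContinuityZ3.Theorems.ThreePointCPIRootEntry
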